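import Summits.BirchSwinnertonDyer.Rank1Residual.Additive.X3SharpResidue
import Summits.BirchSwinnertonDyer.Rank1Residual.Supersingular.DescentLowerBound
import HarnessLib

/-!
# X3 ∧ `r_an = 0` ∧ semistable twist, every odd `p`: the LOWER residue closes PER PAIR by ONE
# descent certificate — `p^{2k-1} ∣ #Ш` or `Sel^(p)(E/ℚ) ≠ 0` with `p ∤ #E(ℚ)_tors`
# (cell `b2b-bsdres`, seat additive-p4 gen 15, line V25b for X3; companion of `Additive/X3SharpResidue.lean`)

HONEST FRAMING (cell `b2b-bsdres`, run/shared/lean/b2b/bsd-rank1-residual/, verbatim in every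
file): the goal of the cell is to DELETE the COMBINATION-SHAPED residual classes of the
Birch–Swinnerton-Dyer formula for ALL analytic-rank `≤ 1` elliptic curves over `ℚ` — "full BSD
formula for every rank `≤ 1` curve in class `C`" assembled STRICTLY from published theorems — so
that the rank-`≤ 1` remainder becomes exactly the CONSTRUCTION-SHAPED classes, which are TYPED
(missing-input `Prop`s), NOT attempted. This is not "finishing BSD". Sub-cell additive-p4 (X3♯/X4♯
direct): research route on the CONSTRUCTION-SHAPED class X3; PER-PAIR certificate consumers, not a
class theorem; the label X3 is UNCHANGED; nothing is booked by this file. Theorems only (no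
definition, no named fact minted; every published input is an explicit named-fact hypothesis).

## What this file proves

Gen 14's `x3Sharp_iff_residues` (`Additive/X3SharpResidue.lean`) reduces X3♯ on its (M) ∪ (G-ord,
`e = 2`) rank-`0` rows to the LOWER half `ord_p #Ш_an ≤ ord_p #Ш` (the `ω^{(p−1)/2}`-branch
main-conjecture EQUALITY, printed nowhere — REPAIR-CENSUS gen 11/14). Window census (R3 table,
N < 2·10⁴): 454 such rows, of which exactly 5 have `p ∣ #Ш_an` (all `p = 3`, `#Ш_an = 9`,
`#E(ℚ)_tors ∈ {1, 2}`). This file records that these rows are CERTIFICATE-SHAPED per pair, in the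
vocabulary of the X3 chain of record (`ClassX3.bsdp_rankZero_of_subSemistableTwist_of_lower`: four
named facts — Delbourgo 1998 Prop. 4 `hDel`, modular parametrisation data `hmodD`, Wuthrich 2014
Thm. 16 half-eigen divisibility `hW16`, Wuthrich component `hWu` — + GZK + modularity; NO image,
Tamagawa or Manin hypothesis):

* `ClassX3.bsdp_rankZero_of_subSemistableTwist_of_casselsTate_of_pow_dvd` — `#Ш_an = q`,
  `ord_p q ≤ 2k`, certificate `p^{2k−1} ∣ #Ш(E/ℚ)` ⟹ `BSD(E,p)` (Cassels–Tate squareness `hCT`,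
  `Typed.missingLowerBoundAt_of_casselsTate_of_pow_dvd`);
* `ClassX3.bsdp_rankZero_of_subSemistableTwist_of_casselsTate_of_selmerGroup_ne_bot` — on the
  `ord_p #Ш_an ≤ 2` rows with `p ∤ #E(ℚ)_tors` (a per-pair binder here: `E[p]` is REDUCIBLE on X3, so
  `E(ℚ)[p] ≠ 0` is possible in general; on the 5 window rows `#E(ℚ)_tors ∈ {1,2}`), the native line
  `Sel^(p)(E/ℚ) ≠ 0` suffices (x10b's class-free
  `Supersingular.missingLowerBoundAt_of_casselsTate_of_selmerGroup_ne_bot`: rank `0` and no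
  `p`-torsion make a non-zero Selmer class a non-zero element of `Ш[p]`).

Nothing is certified here; X3 stays CONSTRUCTION-SHAPED; nothing booked.

References: Delbourgo 1998 [Delbourgo1998] Prop. 4; Wuthrich 2014 [Wuthrich2014] Thm. 16;
Cassels 1962 / Silverman *AEC* [SilvermanAEC2009] Thm. X.4.2, X.4.14; Miller 2011 [Miller2011LMS] Def. 1.1.
-/

noncomputable section

open scoped Classical

open WeierstrassCurve Literature.NumberTheory.EllipticCurves
  Literature.NumberTheory.EllipticCurves.ModularForms
  Literature.NumberTheory.EllipticCurves.Rank1Residual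
  Literature.NumberTheory.EllipticCurves.Rank1Residual.Typed

namespace Summit.BirchSwinnertonDyer.Rank1Residual.Additive

variable (W : WeierstrassCurve ℚ) [W.IsElliptic] [W.IsGloballyMinimal] (p : ℕ) [hp : Fact p.Prime]

/-- **X3 ∧ `r_an = 0` ∧ semistable twist: the LOWER residue closes per pair by a divisibility
certificate.** `ClassX3 W p`, `p ≠ 2`, `r_an = 0`, (M) or (G-ord, `e = 2`) (`SubSemistableTwist`),
`#Ш_an = q` with `ord_p q ≤ 2k`, and `p^{2k−1} ∣ #Ш(E/ℚ)` ⟹ `BSD(E,p)`: Cassels–Tate (`hCT`) gives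
the LOWER half, the four named facts the UPPER half. [cite: Delbourgo1998, Prop. 4 (p. 144)]
[cite: Wuthrich2014, Thm. 16 (p. 397)] [cite: SilvermanAEC2009, Thm. X.4.14] [cite: Miller2011LMS, §1 and Def. 1.1] -/
theorem ClassX3.bsdp_rankZero_of_subSemistableTwist_of_casselsTate_of_pow_dvd
    (hDel : Delbourgo1998.prop4_rankZero_pow_dvd_constantCoeff)
    (hGZK : rank_eq_analyticRank_of_analyticRank_le_one) (hmod : hasEntireLFunction_rat)
    (hmodD : nonempty_modularParametrizationData)
    (hW16 : Wuthrich2014.thm16_halfEigenCharIdeal_dvd_cyclotomicPrime)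
    (hWu : Wuthrich2014.charIdeal_dvd_padicLFunctionBranch_component)
    (hCT : exists_casselsTate_pairing (K := ℚ))
    (hp2 : p ≠ 2) (hX : ClassX3 W p) (hr : W.analyticRank = 0) (hS : SubSemistableTwist W p)
    {q : ℚ} (hq : shaAn W = (q : ℂ)) {k : ℕ} (hv : padicValRat p q ≤ 2 * k)
    (hdvd : p ^ (2 * k - 1) ∣ W.shaOrder) : BSDp W p :=
  ClassX3.bsdp_rankZero_of_subSemistableTwist_of_lower W p hDel hGZK hmod hmodD hW16 hWu hp2 hX hr hS
    (missingLowerBoundAt_of_casselsTate_of_pow_dvd W p hCT (hGZK W (by rw [hr]; norm_num)).2 hq hv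
      hdvd)

/-- **X3 ∧ `r_an = 0` ∧ semistable twist, `ord_p #Ш_an ≤ 2`, `p ∤ #E(ℚ)_tors`: the LOWER residue
closes by the native line `Sel^(p)(E/ℚ) ≠ 0`.** (`p ∤ #E(ℚ)_tors` is a per-pair binder on X3 —
`E[p]` is reducible; rank `0` by GZK.) Census: the 5 window rows of the R3 table with `3 ∣ #Ш_an`
(`#Ш_an = 9`, `#E(ℚ)_tors ∈ {1, 2}`). [cite: Delbourgo1998, Prop. 4 (p. 144)]
[cite: Wuthrich2014, Thm. 16 (p. 397)] [cite: SilvermanAEC2009, Thm. X.4.2 and Thm. X.4.14]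
[cite: Miller2011LMS, §1 and Def. 1.1] -/
theorem ClassX3.bsdp_rankZero_of_subSemistableTwist_of_casselsTate_of_selmerGroup_ne_bot
    (hDel : Delbourgo1998.prop4_rankZero_pow_dvd_constantCoeff)
    (hGZK : rank_eq_analyticRank_of_analyticRank_le_one) (hmod : hasEntireLFunction_rat)
    (hmodD : nonempty_modularParametrizationData)
    (hW16 : Wuthrich2014.thm16_halfEigenCharIdeal_dvd_cyclotomicPrime)
    (hWu : Wuthrich2014.charIdeal_dvd_padicLFunctionBranch_component)
    (hCT : exists_casselsTate_pairing (K := ℚ))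
    (hp2 : p ≠ 2) (hX : ClassX3 W p) (hr : W.analyticRank = 0) (hS : SubSemistableTwist W p)
    (htors : ¬ p ∣ W.torsionOrder)
    {q : ℚ} (hq : shaAn W = (q : ℂ)) (hv : padicValRat p q ≤ 2)
    (hSel : W.selmerGroup (p : ℤ) ≠ ⊥) : BSDp W p :=
  ClassX3.bsdp_rankZero_of_subSemistableTwist_of_lower W p hDel hGZK hmod hmodD hW16 hWu hp2 hX hr hS
    (Supersingular.missingLowerBoundAt_of_casselsTate_of_selmerGroup_ne_bot W p hCT hGZK hr htors hq
      hv hSel)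

end Summit.BirchSwinnertonDyer.Rank1Residual.Additive

end
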